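import Summits.BirchSwinnertonDyer.BirchSwinnertonDyer.Theorems.KimAtThreePortSharedSATCore
import Summits.BirchSwinnertonDyer.Rank1Residual.GaloisImage.PropagatedStructure
import Literature.NumberTheory.EllipticCurves.Kato2004.EulerSystemValues
import Mathlib.RingTheory.Adjoin.PowerBasis
import Mathlib.NumberTheory.Cyclotomic.PrimitiveRoots
import HarnessLib

/-!
# The two-exponent rider (ii₂) of the uniform fine Kato package, DERIVED from a crude exp*-compatibility
# clause — crux `DeepUpperAtThree` (stmt-BirchSwinnertonDyer-19076), route W2 `KimAtThreeKolyvagin`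
# (cell `bsd-addord`, seat w2-c3 gen 7; `--supports 19076`, helper)

HONEST FRAMING. TOOL theorems only (no definition, no named fact, no `sorry`); closes nothing; nothing is
booked; BSD is not proved by any of this.  Kato's value datum `Λ` and the scalar dual exponential `φ` at
`ℚ₃` are ABSTRACT binders; the compatibility clause tying them is a DISPLAYED hypothesis.

## What, and why

The uniform package (C1ᵤ) of this seat's gen 6 (`KimAtThreeDeepUpperUniformOfFineKato`, consumed by gen 7's
`KimAtThreeDeepUpperUniformPinned`) displays, at every depth `j`, acc6's TWO-EXPONENT RIDER
`RIDER₂⟦W, j, t, e, v₃, Λ, Λfin_j⟧`: for every tame level `r`, reduction map `Ψ`, `y ∈ H¹(ℚ(μ_r), T₃W)`,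
`κ₀ ∈ H¹(ℚ, E[3^j·3])` with `res κ₀ = Ψ y`, `loc_{v₃} κ₀ ∈ 𝓕_can(v₃)` and `s ∈ ℤ₃`:
`3^t Λ_{0,r}(y) − s ⊗ 1 ∈ 3^{j+1}·L_int ⟹ 3^e · Λfin_j(loc κ₀) = s mod 3^{j+1}`.  On the Kato stratum seat kim3
gen 13 (`KimAtThreeFineKatoRiderAssembly`, p49xxxx) derives the exponent-`0` rider from a SEMI-LOCAL PACKAGE
(SAT₀'s E-side `Λ₀ = log_ω E₀(K_𝔓)` with a unit-trace element, a lattice `M ⊆ Λ₀^∨`, and a compatibility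
clause modulo `3^{j+1}·M`).  For the UNIFORM road none of that fine structure is needed: this file derives
`RIDER₂` at `(t, e)` for the `3^a`-SCALED datum `3^a·Λ` from
* the interface `φ′(y) = s ⇒ Λfin_j(π_{j+1,*} y) = s mod 3^{j+1}` of a NORMALISED `φ′` with `φ = 3^{λ₀}·φ′`
  (this seat's `KimAtThreeDeepUpperLocalLatticeUniform`, from kim3's `hker`/`hdual`), and
* ONE CRUDE COMPATIBILITY CLAUSE (X1-int_b): `∃ l ∈ L_int(m), 3^b·(φ(h) ⊗ 1 − Λ_{0,r}(y)) = 3^{j+1}·l`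
  whenever `h ∈ H¹(ℚ_{v₃}, T₃W)` lifts `loc_{v₃} κ₀` and `res κ₀ = Ψ y` — for Kato's witnesses
  (`Λ := (exp*_ω ∘ loc_𝔓)_𝔓`, `φ := exp*_ω` at `ℚ₃`) this is: `exp*` commutes with restriction, the two
  `T`-classes `res_{K_𝔓} h`, `loc_𝔓 y` differ by `3^{j+1}·H¹(K_𝔓, T)`, and the CRUDE bound
  `3·exp*_ω(H¹(K_𝔓, T)) ⊆ 𝒪_{K_𝔓}` (`K_𝔓/ℚ₃` unramified: `log_ω Ê(𝔭) = 3𝒪`) — so `b = 1` —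
with `a ≥ b` and `e = t + a + λ₀`.  The scalar is extracted from `ℚ₃ ⊗_ℚ ℚ(ζ_m)` WITHOUT a unit-trace element:
§1 builds the COORDINATE FUNCTIONAL `τ` of the `ζ_m`-power basis (`τ(1 ⊗ 1) = 1`, `τ(L_int) ⊆ ℤ₃` by
`PowerBasis.repr_gen_pow_isIntegral` — the powers `ζ^j` have integral coordinates), and §2 runs seat
w2-acc4's scalar core `KimAtThreePortSharedSATCore.toZModPow_eq_of_sub_eq_smul_of_sub_eq_smul` with
`Λ₀ = {1 ⊗ 1}`, `L = M = L_int`.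
* §1 `exists_coordFunctional` (any `p`, `m`).
* §2 `toZModPow_eq_of_sub_eq_smul_cycIntLattice` — `e ⊗ 1 − v ∈ 3^{k+1}L_int ∧ v − s ⊗ 1 ∈ 3^{k+1}L_int ⇒
  e ≡ s (mod 3^{k+1})` (any `p`, `m`).
* §3 `rider₂_of_compat` — **`RIDER₂⟦W, j, t, e, v₃, 3^a·Λ, Λfin_j⟧`** from the interface + X1-int_b at depth
  `j`, `b ≤ a`, `e = t + a + λ₀` (any `W`, `v₃`, `t`).
References: C.-H. Kim, AJM 148 (2026) §3.3–§3.4.1 and the proof of Thm. 3.13 [Kim2022StructureSelmer];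
C.-H. Kim, K. Nakamura, JNT 210 (2020) Thm. 2.1 / Cor. 2.4 [KimNakamura2020]; S. Bloch, K. Kato (1990) §3
[BlochKato1990]; K. Kato, Astérisque 295 (2004) §9.4, Thm. 9.7 [Kato2004Asterisque]; n1011 ROUTE-1 §53.3–§53.4
(D-53-1 … D-53-7); kim3 memo KIM3-W2-C1-g11 §2.4; this seat's HANDOFF (HOME/HANDOFF.md §w2-c3 gen 7).
-/

noncomputable section

-- the cell's Theorems namespace `Summit.BirchSwinnertonDyer.BirchSwinnertonDyer.…` repeats the summit name by design (D-0017)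
set_option linter.dupNamespace false

open scoped Classical NumberField TensorProduct ContRepresentation
open Field NumberField IsDedekindDomain
open WeierstrassCurve Literature.NumberTheory.EllipticCurves Literature.NumberTheory.GaloisRepresentations
  Literature.NumberTheory.GaloisRepresentations.DiscreteGaloisModule Literature.NumberTheory.GaloisCohomology
open Literature.NumberTheory.EllipticCurves.Kato2004 Literature.NumberTheory.EllipticCurves.Kato2004.EulerSystemValues
open Summit.BirchSwinnertonDyer.Rank1Residual.GaloisImage
open Summit.BirchSwinnertonDyer.BirchSwinnertonDyer.Theorems

namespace Summit.BirchSwinnertonDyer.BirchSwinnertonDyer.Theorems.KimAtThreeDeepUpperRiderOfCompat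

/-! ### §1. The coordinate functional of the `ζ_m`-power basis on `ℚ_p ⊗_ℚ ℚ(ζ_m)` -/

section Coord

variable (p : ℕ) [Fact p.Prime] (m : ℕ) [NeZero m]

set_option backward.isDefEq.respectTransparency false in
/-- **A `ℚ_p`-linear functional `τ` on `ℚ_p ⊗_ℚ ℚ(ζ_m)` with `τ(1 ⊗ 1) = 1` and `τ(L_int(m)) ⊆ ℤ_p`**: the
coordinate of `1 = ζ^0` in the `ℚ_p`-basis `{1 ⊗ ζ^i}_{i < φ(m)}` (base change of the power basis of
`ζ = zeta m`); integrality on `L_int = ℤ_p⟨1 ⊗ ζ^j : j ≥ 0⟩` because every power `ζ^j` has INTEGER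
coordinates in the power basis (`ζ` is an algebraic integer whose minimal polynomial over `ℚ` is the integer
one — `PowerBasis.repr_gen_pow_isIntegral`).  Replaces the unit-trace element of SAT₀ on the uniform road.
[folklore] -/
theorem exists_coordFunctional :
    ∃ τ : (ℚ_[p] ⊗[ℚ] CyclotomicField m ℚ) →ₗ[ℚ_[p]] ℚ_[p],
      τ ((1 : ℚ_[p]) ⊗ₜ[ℚ] (1 : CyclotomicField m ℚ)) = 1 ∧
      ∀ l ∈ cycIntLattice p m, ‖τ l‖ ≤ 1 := by
  set K := CyclotomicField m ℚ
  have hζ := IsCyclotomicExtension.zeta_spec m ℚ K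
  set pb : PowerBasis ℚ K := hζ.powerBasis ℚ with hpb
  have hgen : pb.gen = IsCyclotomicExtension.zeta m ℚ K := by
    rw [hpb, IsPrimitiveRoot.powerBasis_gen]
  set i₀ : Fin pb.dim := ⟨0, pb.dim_pos⟩ with hi₀
  set B := Algebra.TensorProduct.basis ℚ_[p] pb.basis with hB
  have hcoord : ∀ (c : ℚ_[p]) (x : K),
      B.coord i₀ (c ⊗ₜ[ℚ] x) = c * algebraMap ℚ ℚ_[p] (pb.basis.repr x i₀) := by
    intro c x
    rw [Module.Basis.coord_apply, hB, Algebra.TensorProduct.basis_repr_tmul, Finsupp.smul_apply,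
      Finsupp.mapRange_apply, smul_eq_mul]
  refine ⟨B.coord i₀, ?_, ?_⟩
  · have h1 : (1 : K) = pb.basis i₀ := by rw [pb.basis_eq_pow]; simp [hi₀]
    rw [hcoord, h1, pb.basis.repr_self, Finsupp.single_eq_same, map_one, mul_one]
  · intro l hl
    have hint : IsIntegral ℤ pb.gen := by
      rw [hgen]; exact hζ.isIntegral (NeZero.pos m)
    have hmin : minpoly ℚ pb.gen = (minpoly ℤ pb.gen).map (algebraMap ℤ ℚ) :=
      minpoly.isIntegrallyClosed_eq_field_fractions' ℚ hint
    unfold cycIntLattice at hl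
    refine Submodule.span_induction (p := fun l _ => ‖B.coord i₀ l‖ ≤ 1) ?_ ?_ ?_ ?_ hl
    · rintro _ ⟨j, rfl⟩
      dsimp only
      obtain ⟨n, hn⟩ := IsIntegrallyClosed.isIntegral_iff.mp
        (PowerBasis.repr_gen_pow_isIntegral hint hmin j i₀)
      rw [← hgen, Algebra.TensorProduct.tmul_pow, one_pow, hcoord, one_mul, ← hn]
      simp only [algebraMap_int_eq, eq_intCast, map_intCast]
      exact Padic.norm_int_le_one n
    · rw [map_zero, norm_zero]; exact zero_le_one
    · intro a b _ _ ha hb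
      rw [map_add]
      exact (Padic.nonarchimedean _ _).trans (max_le ha hb)
    · intro r a _ ha
      rw [KimAtThreePortSharedSATCore.padicInt_smul_eq_coe_smul, map_smul, smul_eq_mul, norm_mul]
      exact mul_le_one₀ (PadicInt.norm_le_one r) (norm_nonneg _) ha

/-! ### §2. Scalar extraction modulo `L_int`: no unit-trace element needed -/

set_option backward.isDefEq.respectTransparency false in
/-- **`e ⊗ 1 − v ∈ p^{k+1}·L_int` and `v − s ⊗ 1 ∈ p^{k+1}·L_int` ⇒ `e ≡ s (mod p^{k+1})`** for
`e, s ∈ ℤ_p` and any `v ∈ ℚ_p ⊗ ℚ(ζ_m)` — w2-acc4's `toZModPow_eq_of_sub_eq_smul_of_sub_eq_smul` run with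
the coordinate functional of §1, `Λ₀ = {1 ⊗ 1}`, `L = M = L_int(m)` (so `(L_int + L_int) ∩ ℚ_p ⊆ ℤ_p`).
[cite: Kim2022StructureSelmer, §3.4.1 and the proof of Thm. 3.13 (arXiv v3 pp. 26–27)] -/
theorem toZModPow_eq_of_sub_eq_smul_cycIntLattice {e s : ℤ_[p]} {v : ℚ_[p] ⊗[ℚ] CyclotomicField m ℚ}
    {k : ℕ}
    (he : ∃ μ ∈ cycIntLattice p m, ((e : ℚ_[p]) ⊗ₜ[ℚ] (1 : CyclotomicField m ℚ)) - v =
      ((p : ℤ_[p]) ^ (k + 1)) • μ)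
    (hs : ∃ l ∈ cycIntLattice p m, v - ((s : ℚ_[p]) ⊗ₜ[ℚ] (1 : CyclotomicField m ℚ)) =
      ((p : ℤ_[p]) ^ (k + 1)) • l) :
    PadicInt.toZModPow (k + 1) e = PadicInt.toZModPow (k + 1) s := by
  obtain ⟨τ, hτ1, hτ⟩ := exists_coordFunctional p m
  obtain ⟨μ, hμ, he⟩ := he
  obtain ⟨l, hl, hs⟩ := hs
  have h11 : ((1 : ℚ_[p]) ⊗ₜ[ℚ] (1 : CyclotomicField m ℚ)) = (1 : ℚ_[p] ⊗[ℚ] CyclotomicField m ℚ) := rfl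
  have hL : ∀ o ∈ (cycIntLattice p m : Submodule ℤ_[p] (ℚ_[p] ⊗[ℚ] CyclotomicField m ℚ)),
      ∀ ℓ ∈ ({(1 : ℚ_[p]) ⊗ₜ[ℚ] (1 : CyclotomicField m ℚ)} : Set (ℚ_[p] ⊗[ℚ] CyclotomicField m ℚ)),
      ‖τ (o * ℓ)‖ ≤ 1 := by
    intro o ho ℓ hℓ
    rw [Set.mem_singleton_iff] at hℓ
    rw [hℓ, h11, mul_one]
    exact hτ o ho
  have hu : ∃ ℓ ∈ ({(1 : ℚ_[p]) ⊗ₜ[ℚ] (1 : CyclotomicField m ℚ)} : Set (ℚ_[p] ⊗[ℚ] CyclotomicField m ℚ)),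
      ‖τ ℓ‖ = 1 :=
    ⟨_, Set.mem_singleton _, by rw [hτ1, norm_one]⟩
  rw [KimAtThreePortSharedSATCore.coe_tmul_one_eq_algebraMap] at he hs
  exact KimAtThreePortSharedSATCore.toZModPow_eq_of_sub_eq_smul_of_sub_eq_smul τ
    (L := cycIntLattice p m) (M := cycIntLattice p m) hL hL hu hμ hl he hs

end Coord

/-! ### §3. The two-exponent rider of the scaled datum from the interface + the crude compatibility -/

section Rider

/-- Local notation: the TWO-EXPONENT rider clause (ii₂) at depth `j`, torsion exponent `t`, defect exponent
`e`, place `v`, for the pair `(Λ, Λf)` — seat acc6's spelling (`KimAtThreeTwoExponentWitnessPair`), copied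
VERBATIM from gen 6's `KimAtThreeDeepUpperUniformOfFineKato`. -/
local notation3 (prettyPrint := false) "RIDER₂⟦" W' ", " j ", " t' ", " e' ", " v' ", " Λ' ", " Λf "⟧" =>
  ∀ (r : Finset (HeightOneSpectrum (𝓞 ℚ)))
    (Ψ : H1 (tateRep W' 3) (cycSubgroup 3 0 r) →+
      continuousCohomology 1
        (subgroupRep (WeierstrassCurve.torsionGaloisModule W' (((3 : ℕ) : ℤ) ^ j * ((3 : ℕ) : ℤ))).toTopRep
          (cycSubgroup 3 0 r))),
    (∀ (φ : contOneCocycles (subgroupRep (tateRep W' 3).toTopRep (cycSubgroup 3 0 r)))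
        (ψ : contOneCocycles
          (subgroupRep (WeierstrassCurve.torsionGaloisModule W' (((3 : ℕ) : ℤ) ^ j * ((3 : ℕ) : ℤ))).toTopRep
            (cycSubgroup 3 0 r))),
        (∀ g, ((ψ.1 g : geomTorsion W' (((3 : ℕ) : ℤ) ^ j * ((3 : ℕ) : ℤ))) : geomPoints W') =
          TateModule.proj 3 (j + 1) (φ.1 g)) →
        Ψ (oneCocycleClass _ φ) = oneCocycleClass _ ψ) →
    ∀ (y : H1 (tateRep W' 3) (cycSubgroup 3 0 r))
      (κ₀ : galoisCohomology (WeierstrassCurve.torsionGaloisModule W' (((3 : ℕ) : ℤ) ^ j * ((3 : ℕ) : ℤ))) 1)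
      (s : ℤ_[3]),
      resSubgroup (WeierstrassCurve.torsionGaloisModule W' (((3 : ℕ) : ℤ) ^ j * ((3 : ℕ) : ℤ))).toTopRep
          (cycSubgroup 3 0 r) 1 κ₀ = Ψ y →
      galoisCohomology.localization (WeierstrassCurve.torsionGaloisModule W' (((3 : ℕ) : ℤ) ^ j * ((3 : ℕ) : ℤ)))
          (Sum.inr v') 1 κ₀ ∈ propagatedSelmerStructure W' 3 j (Sum.inr v') →
      (∃ l ∈ cycIntLattice 3 (cycLevel 3 0 r),
          (((3 : ℕ) : ℤ_[3]) ^ t') • Λ' 0 r y - ((s : ℚ_[3]) ⊗ₜ[ℚ] (1 : CyclotomicField (cycLevel 3 0 r) ℚ)) =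
            (((3 : ℕ) : ℤ_[3]) ^ (j + 1)) • (l : ℚ_[3] ⊗[ℚ] CyclotomicField (cycLevel 3 0 r) ℚ)) →
      ((3 ^ e' : ℕ) : ZMod (3 ^ (j + 1))) *
        Λf (galoisCohomology.localization
          (WeierstrassCurve.torsionGaloisModule W' (((3 : ℕ) : ℤ) ^ j * ((3 : ℕ) : ℤ))) (Sum.inr v') 1 κ₀) =
        PadicInt.toZModPow (j + 1) s

variable (W : WeierstrassCurve ℚ) [W.IsElliptic] [ContinuousSMul ℤ_[3] (W.tateModule 3)]
  (v₃ : HeightOneSpectrum (𝓞 ℚ))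
  (Λ : ∀ (k' : ℕ) (r : Finset (HeightOneSpectrum (𝓞 ℚ))),
    H1 (tateRep W 3) (cycSubgroup 3 k' r) →ₗ[ℤ_[3]] ℚ_[3] ⊗[ℚ] CyclotomicField (cycLevel 3 k' r) ℚ)
  (φ φ' : (tateLocalRep W 3 (Sum.inr v₃)).cohomology 1 →+ ℚ_[3])

set_option backward.isDefEq.respectTransparency false in
/-- **`RIDER₂⟦W, j, t, e, v₃, 3^a·Λ, Λfin_j⟧` DERIVED** from: the interface of a NORMALISED `φ′`
(`φ′(y) = s ⇒ Λfin_j(π_{j+1,*} y) = s mod 3^{j+1}`, this seat's `KimAtThreeDeepUpperLocalLatticeUniform`), the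
scaling `φ = 3^{λ₀}·φ′`, and the CRUDE COMPATIBILITY CLAUSE X1-int_b at depth `j` between Kato's abstract value
datum `Λ_{0,r}` and `φ` (DISPLAYED: `∃ l ∈ L_int, 3^b·(φ(h) ⊗ 1 − Λ_{0,r}(y)) = 3^{j+1}·l` for every `T`-lift `h`
of `loc_{v₃} κ₀` with `res κ₀ = Ψ y` — `exp*` commutes with restriction + `3·exp*_ω(H¹(K_𝔓,T)) ⊆ 𝒪_{K_𝔓}` for
Kato's witnesses, `b = 1`), whenever `b ≤ a` and `e = t + a + λ₀`.  Proof: lift `loc κ₀` to `h` (`𝓕_can`),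
`Λfin_j(loc κ₀) = φ′(h) mod 3^{j+1}` (interface), and with `E := 3^e φ′(h) = 3^{t+a} φ(h)`:
`E ⊗ 1 − 3^t(3^aΛ)(y) = 3^{t+a−b}·3^b(φ(h) ⊗ 1 − Λ y) ∈ 3^{j+1}L_int`, the premise gives
`3^t(3^aΛ)(y) − s ⊗ 1 ∈ 3^{j+1}L_int`, and §2 concludes `E ≡ s`.  Any `W`, `v₃`, `t`; nothing about `exp*` is
constructed. [cite: Kim2022StructureSelmer, §3.3–§3.4.1 and the proof of Thm. 3.13 (arXiv v3 pp. 26–27)]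
[cite: KimNakamura2020, Thm. 2.1 and Cor. 2.4] [cite: BlochKato1990, §3 (Prop. 3.8, Ex. 3.11)] -/
theorem rider₂_of_compat (lam : ℤ) (hφ : ∀ y, φ y = (3 : ℚ_[3]) ^ lam * φ' y) (hint' : ∀ y, ‖φ' y‖ ≤ 1)
    (j : ℕ)
    (Λfin : galoisCohomology ((W.torsionGaloisModule (((3 : ℕ) : ℤ) ^ j * ((3 : ℕ) : ℤ))).toLocal
      (Sum.inr v₃)) 1 →+ ZMod (3 ^ (j + 1)))
    (hI : ∀ (y : (tateLocalRep W 3 (Sum.inr v₃)).cohomology 1) (s : ℤ_[3]), φ' y = s →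
      Λfin (tateLocalMap W 3 j (Sum.inr v₃) y) = PadicInt.toZModPow (j + 1) s)
    (b : ℕ)
    (hcompat : ∀ (r : Finset (HeightOneSpectrum (𝓞 ℚ)))
      (Ψ : H1 (tateRep W 3) (cycSubgroup 3 0 r) →+
        continuousCohomology 1 (subgroupRep
          (W.torsionGaloisModule (((3 : ℕ) : ℤ) ^ j * ((3 : ℕ) : ℤ))).toTopRep (cycSubgroup 3 0 r))),
      (∀ (φ₁ : contOneCocycles (subgroupRep (tateRep W 3).toTopRep (cycSubgroup 3 0 r)))
          (ψ : contOneCocycles (subgroupRep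
            (W.torsionGaloisModule (((3 : ℕ) : ℤ) ^ j * ((3 : ℕ) : ℤ))).toTopRep (cycSubgroup 3 0 r))),
          (∀ g, ((ψ.1 g : geomTorsion W (((3 : ℕ) : ℤ) ^ j * ((3 : ℕ) : ℤ))) : geomPoints W) =
            TateModule.proj 3 (j + 1) (φ₁.1 g)) →
          Ψ (oneCocycleClass _ φ₁) = oneCocycleClass _ ψ) →
      ∀ (y : H1 (tateRep W 3) (cycSubgroup 3 0 r))
        (κ₀ : galoisCohomology (W.torsionGaloisModule (((3 : ℕ) : ℤ) ^ j * ((3 : ℕ) : ℤ))) 1)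
        (h : (tateLocalRep W 3 (Sum.inr v₃)).cohomology 1),
        resSubgroup (W.torsionGaloisModule (((3 : ℕ) : ℤ) ^ j * ((3 : ℕ) : ℤ))).toTopRep
            (cycSubgroup 3 0 r) 1 κ₀ = Ψ y →
        galoisCohomology.localization (W.torsionGaloisModule (((3 : ℕ) : ℤ) ^ j * ((3 : ℕ) : ℤ)))
            (Sum.inr v₃) 1 κ₀ = tateLocalMap W 3 j (Sum.inr v₃) h →
        ∃ l ∈ cycIntLattice 3 (cycLevel 3 0 r),
          (((3 : ℕ) : ℤ_[3]) ^ b) • ((φ h ⊗ₜ[ℚ] (1 : CyclotomicField (cycLevel 3 0 r) ℚ)) - Λ 0 r y) =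
            (((3 : ℕ) : ℤ_[3]) ^ (j + 1)) • (l : _))
    (a t e : ℕ) (hab : b ≤ a) (he : (e : ℤ) = (t : ℤ) + a + lam) :
    RIDER₂⟦W, j, t, e, v₃, (fun k' r => (((3 : ℕ) : ℤ_[3]) ^ a) • Λ k' r), Λfin⟧ := by
  intro r Ψ hΨ y κ₀ s hres hloc hprem
  obtain ⟨h, hh⟩ := (mem_propagatedSelmerStructure_iff W 3 j (Sum.inr v₃) _).mp hloc
  obtain ⟨l₂, hl₂, hc⟩ := hcompat r Ψ hΨ y κ₀ h hres hh.symm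
  obtain ⟨l₁, hl₁, hs⟩ := hprem
  -- the integer `E := 3^e · φ′(h) = 3^{t+a} · φ(h)`
  set sh : ℤ_[3] := ⟨φ' h, hint' h⟩ with hsh
  have hφ'h : φ' h = (sh : ℚ_[3]) := rfl
  set E : ℤ_[3] := ((3 : ℕ) : ℤ_[3]) ^ e * sh with hE
  have h3 : ((3 : ℕ) : ℚ_[3]) ≠ 0 := by norm_num
  have hEq : (E : ℚ_[3]) = ((3 : ℕ) : ℚ_[3]) ^ (t + a) * φ h := by
    rw [hE, PadicInt.coe_mul, PadicInt.coe_pow, PadicInt.coe_natCast, ← hφ'h, hφ h, ← mul_assoc]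
    congr 1
    rw [← zpow_natCast, ← zpow_natCast, Nat.cast_ofNat, ← zpow_add₀ (by norm_num : (3 : ℚ_[3]) ≠ 0), he]
    push_cast
    ring_nf
  -- the value side: `Λfin (loc κ₀) = φ′(h) mod 3^{j+1}`
  rw [← hh, hI h sh hφ'h]
  have hlhs : ((3 ^ e : ℕ) : ZMod (3 ^ (j + 1))) * PadicInt.toZModPow (j + 1) sh =
      PadicInt.toZModPow (j + 1) E := by
    rw [hE, map_mul, map_pow, map_natCast, Nat.cast_pow]
  rw [hlhs]
  -- §2 with `v := 3^t · (3^a Λ)_{0,r}(y)`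
  refine toZModPow_eq_of_sub_eq_smul_cycIntLattice 3 (cycLevel 3 0 r) ?_ ⟨l₁, hl₁, hs⟩
  -- `E ⊗ 1 − 3^t • 3^a • Λ y = 3^{t+a} • (φ h ⊗ 1 − Λ y) = 3^{t+a-b} • 3^b • (…) = 3^{j+1} • (3^{t+a-b} • l₂)`
  set c : ℕ := t + a - b with hcdef
  have htab : t + a = c + b := by omega
  have hv : (((3 : ℕ) : ℤ_[3]) ^ t) • ((((3 : ℕ) : ℤ_[3]) ^ a) • Λ 0 r) y =
      (((3 : ℕ) : ℤ_[3]) ^ (t + a)) • Λ 0 r y := by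
    rw [LinearMap.smul_apply, smul_smul, ← pow_add]
  have hE1 : ((E : ℚ_[3]) ⊗ₜ[ℚ] (1 : CyclotomicField (cycLevel 3 0 r) ℚ)) =
      (((3 : ℕ) : ℤ_[3]) ^ (t + a)) • (φ h ⊗ₜ[ℚ] (1 : CyclotomicField (cycLevel 3 0 r) ℚ)) := by
    rw [hEq, KimAtThreePortSharedSATCore.padicInt_smul_eq_coe_smul, PadicInt.coe_pow, PadicInt.coe_natCast,
      TensorProduct.smul_tmul', smul_eq_mul]
  refine ⟨(((3 : ℕ) : ℤ_[3]) ^ c) • l₂, (cycIntLattice 3 (cycLevel 3 0 r)).smul_mem _ hl₂, ?_⟩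
  change ((E : ℚ_[3]) ⊗ₜ[ℚ] (1 : CyclotomicField (cycLevel 3 0 r) ℚ)) -
      (((3 : ℕ) : ℤ_[3]) ^ t) • ((((3 : ℕ) : ℤ_[3]) ^ a) • Λ 0 r) y = _
  rw [hv, hE1, ← smul_sub, htab, pow_add, mul_smul, hc, smul_smul, smul_smul, mul_comm]

end Rider

end Summit.BirchSwinnertonDyer.BirchSwinnertonDyer.Theorems.KimAtThreeDeepUpperRiderOfCompat

end
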